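import Literature.MathematicalPhysics.QuantumFieldTheory.Balaban1983to89.HiggsLattice
import Literature.MathematicalPhysics.QuantumFieldTheory.Balaban1983to89.LatticeFieldCalculus

/-!
# `Balaban1983to89.B1Eq17Urep` — T. Bałaban, *(Higgs)₂,₃ quantum fields in a finite volume. I. A lower bound*,
Commun. Math. Phys. **85** (1982) 603–626 [Balaban1982Higgs1], (1.7) p. 605 (= *Regularity and decay of lattice Green's
functions*, Commun. Math. Phys. **89** (1983) 571–597 [Balaban1983RegularityDecay], (1.2) p. 572): the CONCRETE abelian
structure-group representation `U(A) = exp(qεeA)` on `R^N` instantiating the parameter `Urep` of the cross-paper lattice calculus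

statement-level skeleton of published theorems with citation tags; proofs where landed; nothing here is a claim about the Yang–Mills mass gap

PDF held: `paper:balaban1982-cmp85-higgs23-i` (journal page = PDF page + 602); `paper:balaban1983-cmp89-regularity-decay`
(journal page = PDF page + 570).  Displays read on the ×2 page renders
`run/shared/lean/pub/pub-balaban/b2b-balaban-ref1/pages/1982-cmp85-higgs23-I/…-p003-x2.png` (p. 605) and
`…/1983-cmp89-regularity-decay/…-p002-x2.png` (p. 572), as images.

CITATION HEADER / WHAT IS REPRODUCED.  p. 605 [PDF 3], verbatim: *"a representation of the additive group of real numbers R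
in unitary operators on R^N: U(A) = exp(qεeA), A ∈ R, where e is a coupling constant and q is an antisymmetric N × N matrix.
We will assume only that ‖q‖ ≤ 1."*; [Balaban1983RegularityDecay] (1.2) p. 572 [PDF 2], verbatim: *"U(A) = e^{qeηA}, q is an
antisymmetric N × N matrix, where e is a real parameter."*  The cross-paper lattice calculus
`…Balaban1983to89.LatticeFieldCalculus` (unit lit-balaban-r18) types the covariant derivative (1.7) `covDerivScalar`, the
covariant Laplace form (1.3) `covLaplaceForm`, the covariant block average (1.4) `covSiteAvg` and the actions (1.8)/(1.11)
`higgsAction`/`feynmanHiggsAction` over an ABSTRACT representation parameter `Urep : ℝ → W →ₗ[ℝ] W`, with the standing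
hypothesis `Urep 0 = LinearMap.id` of its `A = 0` reductions (`covDerivScalar_zero`, `covSiteAvg_zero`) left open; the
concrete `U(A) = exp(qηeA)` exists in the tree as `…Balaban1983to89.HiggsLattice.ChargeData.U` (a continuous linear map on
`EuclideanSpace ℝ (Fin N)`, with `U_add`, `U_zero`, `star_U`, `U_mem_unitary` PROVED there).  THIS FILE is the 10-line bridge
the lit-balaban SKELETON lists as reserve R7 (= r18's cross-paper row G08, PHASE2-TARGETS §G.3): `ChargeData.Urep C η` IS that
parameter for the printed representation, and the standing hypothesis and the two `A = 0` reductions are DISCHARGED for it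
(`Urep_zero`, `covDerivScalar_Urep_zero`, `covSiteAvg_Urep_zero`), together with the printed properties "representation"
(`Urep_add`) and "in unitary operators" (`norm_Urep_apply`: `|U(A)φ| = |φ|`).  Nothing is restated: every object is the
existing one; no statement of the paper beyond these one-line remarks of p. 605 is asserted.  SKELETON rows served: B1.Eq1.7
(the representation clause, concrete instance on the V1 calculus), B4.Eq1.2.  Unit `lit-balaban-p32` (Phase-2 proof seat p32,
reserve R7), HOME `run/shared/lean/pub/lit-balaban/`.
-/

namespace Literature.MathematicalPhysics.QuantumFieldTheory.Balaban1983to89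

noncomputable section

namespace HiggsLattice.ChargeData

variable {N : ℕ} (C : HiggsLattice.ChargeData N)

/-- **(1.7) p. 605 [PDF 3] / [Balaban1983RegularityDecay] (1.2) p. 572**, verbatim: *"U(A) = exp(qεeA), A ∈ R, where e is a
coupling constant and q is an antisymmetric N × N matrix"* — typed reading: the printed representation, on the lattice of spacing
`η`, AS the parameter `Urep : ℝ → W →ₗ[ℝ] W` (`W = R^N = EuclideanSpace ℝ (Fin N)`) of `LatticeFieldCalculus.covDerivScalar` /
`covSiteAvg` / `higgsAction`: `A ↦ U(A) = exp(qηeA)` (the existing `ChargeData.U`, read as a linear map).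
[cite: Balaban1982Higgs1, (1.7) p.605] -/
def Urep (η : ℝ) : ℝ → EuclideanSpace ℝ (Fin N) →ₗ[ℝ] EuclideanSpace ℝ (Fin N) :=
  fun A => ((C.U η A : EuclideanSpace ℝ (Fin N) →L[ℝ] EuclideanSpace ℝ (Fin N)) :
    EuclideanSpace ℝ (Fin N) →ₗ[ℝ] EuclideanSpace ℝ (Fin N))

/-- `Urep` acts as `U(A)`. [cite: Balaban1982Higgs1, (1.7) p.605] -/
@[simp] theorem Urep_apply (η A : ℝ) (v : EuclideanSpace ℝ (Fin N)) : C.Urep η A v = C.U η A v := rfl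

/-- p. 605: `U(0) = 1` — the standing hypothesis `Urep 0 = LinearMap.id` of `LatticeFieldCalculus.covDerivScalar_zero` /
`covSiteAvg_zero` HOLDS for the printed representation. [cite: Balaban1982Higgs1, (1.7) p.605] -/
theorem Urep_zero (η : ℝ) : C.Urep η 0 = LinearMap.id := by
  refine LinearMap.ext fun v => ?_
  rw [Urep_apply, U_zero]
  rfl

/-- p. 605, *"a representation of the additive group of real numbers R"*: `U(A + B) = U(A) ∘ U(B)` as linear maps.
[cite: Balaban1982Higgs1, (1.7) p.605] -/
theorem Urep_add (η A B : ℝ) : C.Urep η (A + B) = C.Urep η A ∘ₗ C.Urep η B := by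
  refine LinearMap.ext fun v => ?_
  rw [Urep_apply, U_add]
  rfl

/-- p. 605, *"in unitary operators on R^N"*: `|U(A)φ| = |φ|` (the isometry hypothesis of the tree's II (2.16) mechanism
`B2LargeField.norm_transport_sub_le`, for one bond). [cite: Balaban1982Higgs1, (1.7) p.605] -/
theorem norm_Urep_apply (η A : ℝ) (v : EuclideanSpace ℝ (Fin N)) : ‖C.Urep η A v‖ = ‖v‖ :=
  ContinuousLinearMap.norm_map_of_mem_unitary (C.U_mem_unitary η A) v

/-- p. 605: `U(−A)` inverts `U(A)`: `U(−A) ∘ U(A) = 1` as linear maps. [cite: Balaban1982Higgs1, (1.7) p.605] -/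
theorem Urep_neg_comp (η A : ℝ) : C.Urep η (-A) ∘ₗ C.Urep η A = LinearMap.id := by
  rw [← Urep_add, neg_add_cancel, Urep_zero]

end HiggsLattice.ChargeData

namespace LatticeFieldCalculus

variable {P : Params} {j N : ℕ} (C : HiggsLattice.ChargeData N)

/-- **(1.7) p. 605 at `A = 0`, concrete instance**: for the printed `U(A) = exp(qηeA)` the covariant derivative
`(D_A φ)(b) = c·(U(A_b)φ(b₊) − φ(b₋))` of the V1 calculus reduces at `A = 0` to the plain gradient `∂φ` — the tree's
`covDerivScalar_zero` with its hypothesis `Urep 0 = id` discharged. [cite: Balaban1982Higgs1, (1.7) p.605] -/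
theorem covDerivScalar_Urep_zero (η c : ℝ) (φ : SiteField P j (EuclideanSpace ℝ (Fin N))) :
    covDerivScalar c (C.Urep η) (fun _ => (0 : ℝ)) φ = grad c φ :=
  covDerivScalar_zero c (C.Urep η) (C.Urep_zero η) φ

/-- **[Balaban1983RegularityDecay] (1.4) p. 572 at `A = 0`, concrete instance**: for the printed `U(A) = e^{qeηA}` the
covariant block average `(Q(A)φ)(y) = Σ_{x ∈ B(y)} L^{-d} U(A(Γ_{y,x}))φ(x)` reduces at `A = 0` to the block average `Q'` —
the tree's `covSiteAvg_zero` with its hypothesis discharged. [cite: Balaban1983RegularityDecay, (1.4) p.572] -/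
theorem covSiteAvg_Urep_zero (η : ℝ) (φ : SiteField P j (EuclideanSpace ℝ (Fin N))) :
    covSiteAvg (C.Urep η) (fun _ => (0 : ℝ)) φ = siteAvg φ :=
  covSiteAvg_zero (C.Urep η) (C.Urep_zero η) φ

/-- **[Balaban1983RegularityDecay] (1.3) p. 572, concrete instance**: every term of the covariant Laplace form
`Σ_b η^d |η^{-1}(U(A_b)φ(b₊) − φ(b₋))|²` is, by unitarity of the printed `U`, `η^d η^{-2}|φ(b₊) − U(−A_b)φ(b₋)|²` — the
"gauge away one bond" rewriting used on p. 590 (*"φ(x), φ(x') replaced by φ(x), U(A₀(⟨x,x'⟩))φ(x')"*), here for one bond.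
[cite: Balaban1983RegularityDecay, (1.3) p.572] -/
theorem norm_covDerivScalar_Urep (η c : ℝ) (A : VecField P j ℝ) (φ : SiteField P j (EuclideanSpace ℝ (Fin N)))
    (b : PBond P j) :
    ‖covDerivScalar c (C.Urep η) A φ b‖ = ‖c • (φ b.tgt - C.Urep η (-(A b)) (φ b.src))‖ := by
  unfold covDerivScalar
  rw [norm_smul, norm_smul]
  congr 1
  have h := C.norm_Urep_apply η (-(A b)) (C.Urep η (A b) (φ b.tgt) - φ b.src)
  rw [map_sub, ← LinearMap.comp_apply, C.Urep_neg_comp, LinearMap.id_apply] at h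
  exact h.symm

end LatticeFieldCalculus

end

end Literature.MathematicalPhysics.QuantumFieldTheory.Balaban1983to89
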